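import Summits.QuantumFields.BalabanUV.Beta.GAN24.SpureSlotChargeLevelOne
import Summits.QuantumFields.BalabanUV.Beta.GAN24.WardResidualRotatedVertexPeriodic
import Summits.QuantumFields.BalabanUV.Beta.GAN24.CoDressedColumnSourceSums
import Summits.QuantumFields.BalabanUV.Beta.GAN24.GaugeReadChargeDipole
import Summits.QuantumFields.BalabanUV.Beta.GAN24.WardGammaPlainRowCentred
import Summits.QuantumFields.BalabanUV.Beta.GAN24.ThreeFaceRecClosed

/-!
# `BalabanUV.Beta.GAN24.SpureSlotChargeAllLevels` — binder row G-an2-4 ∕ (CONV-C), the (S) row of RULING R-gan24p1-g27-1 B (viii), the PLAIN sub-row of (W-γ):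
# **THE PLAIN ff SLOT CHARGE OF THE PURE S TABLE IS SLOT-CONSTANT AT EVERY LEVEL — road-P2's displayed `hζS` HOLDS ON THE FIELD–FIELD BLOCK FOR ALL `j`, BY COVARIANCE**
# (G-an2-4 formalisation swarm → CRUX TEAM (2), leaf prover `b2b-balaban-gan24-formalise-leaf-02`, gen 56, PART 6)

NOT IN PRINT; OUR BOOKKEEPING ([folklore] assembly BY NAME of: leaf-02 g56 PART 3 `SpureSlotChargeLevelOne.hasSum_prod_spureRecAt_succ_inl_inl_colH` (plain ff slot charge at level
`j+1` = the ℋ-column read of the level-`j` exit⊗exit slot-charge function `C^{exit}_j`), leaf-10's `WardLocusRecursive.SrecAt_translate` (block covariance ⇒ `C^{exit}_j` is `Lc`-PERIODIC in the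
slot), road-P2 g38's `WardResidualRotatedVertexPeriodic.tsum_colH_mul_eq_blockSum_of_periodic` (a comb-kernel column against an `Lc`-periodic slot function is a BLOCK SUM of SOURCE totals),
leaf-02 g51's `CoDressedColumnSourceSums.tsum_source_colH_coDressKBm_KInvStep` (the source totals: exit indicator × `Lc·colMass`), leaf-06's `GaugeReadChargeDipole.abs_tsum_prod_le_of_biLoc`
(the bound), PART 1 for `j = 0`; 0 `def`, 0 cited fact, 0 `def … : Prop`, 0 sorry).  HONEST FRAMING (cell contract, verbatim): «discharging `BetaPertH` makes Bałaban's UV stability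
UNCONDITIONAL — a real constructive-QFT result; it is NOT the continuum limit and NOT the Clay problem.»  HONEST DEPENDENCY (verbatim): «continuum YM on T⁴ ⇐ BetaPertH ∧ nine spine
estimates (0/9 proved); BetaPertH ⇐ (D1) ∧ (D4) ∧ CAP+tail; G-an2-4 gates asym, D1 and NE2/3/4.»

THE POINT.  PART 4 proved `hζS` at `j = 1` with the VALUE `0` through the relative-inverse Ward pairing.  Slot-CONSTANCY alone — which is all road-P2's `hasSum_comb_gaugeCharge_plain_ctr`
displays — needs much less and holds at EVERY level: the previous member's exit⊗exit slot-charge function `C^{exit}_j(κ,·)` is `Lc`-periodic (block covariance of `SrecAt j` + periodicity of the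
exit weights), and the ℋ-column read of an `Lc`-periodic bounded slot function through the comb kernel `G_j` does not depend on the column (p2's block-sum lemma + my g51 source totals).
* §1 `exitFace_add_zsmul`, **`exitCharge_srecAt_add_zsmul`** (`C^{exit}(SrecAt j; κ, u + Lc•t) = C^{exit}(SrecAt j; κ, u)`), `biLoc_exitPair_mul`, **`abs_exitCharge_srecAt_le`** (a uniform bound
  `Cs·Zl²` from `locStencil_SrecAt`).
* §2 **`tsum_prod_spureRecAt_succ_inl_inl_eq_boxSum`**: `Σ'_{(x,z)} SpureRecAt … (j+1) κ′ u′ x z (inl α)(inl β) = (cE·wE_{j+1})·Lc²σ_j²·Σ_κ Σ_{v∈box} 𝟙[v_κ = Lc−1]·Lc·colMass d Lc j κ κ′·C^{exit}(SrecAt j; κ, v)`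
  — a CLOSED, `u′`-FREE form (only the exit slice of the box enters; `colMass` is diagonal, so only `κ = κ′`): **`hζS` at level `j+1`, every `j`, every ff channel, every in-block root**;
  `exists_slotConst_spureRecAt_succ_inl_inl`, and with PART 1 **`exists_slotConst_spureRecAt_inl_inl`**: for EVERY level `j` there is `ζS : Fin (d+1) → ℝ` with
  `∀ κ u, Σ'_{(x,z)} SpureRecAt d Lc (toSite r) cE cVH cΛ j κ u x z (inl α)(inl β) = ζS κ` — road-P2's displayed hypothesis, DISCHARGED on the ff block at all levels.
* §3 THE CONSUMER: **`exists_hasSum_comb_gaugeCharge_plain_ctr_inl_inl`** — at Bałaban's centre (`Lc` odd), every level `j`, label, slot, ff channel: the plain charge of the (γ) comb letter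
  HAS the (T-F) value `Σ_κ (−2·(cVH·wVH_j)·(σ_j·Lc^{d+1})⁻¹·W^{α⁺}_κ(ν,y′))·ζS κ` for the ζS of §2 — road-P2's plain sub-row with NO displayed hypothesis left on the ff block.
* §4 THE VALUE, BY NAME — PRIOR ART ACKNOWLEDGED: for `3 ≤ Lc` leaf-04 g63's `ThreeFaceRecClosed.hasSum_unitS_SpureRecAt` (p332870 ✓, the «S3C-REC» recursion from the (W-face) graded
  Wilson identity — a DIFFERENT route) already contains, as its FIRST conjunct at `sf = sm = 1`, the plain ff pair charge of `SpureRecAt … j` at a fixed slot `= 0` for EVERY `j`; here it is read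
  into road-P2's currency: **`tsum_prod_spureRecAt_inl_inl_eq_zero`** (`ζS ≡ 0` at every level, `3 ≤ Lc`) and **`hasSum_comb_gaugeCharge_plain_ctr_inl_inl_eq_zero`** — at Bałaban's centre
  (`Lc` odd, `3 ≤ Lc`) the PLAIN ff charge of the (γ) comb letter is `0` per slot AT EVERY LEVEL.  So for `3 ≤ Lc` §2's constancy is a second, covariance-only proof of a consequence of leaf-04's
  theorem; what §2 adds is the closed box-sum identity `C^{plain}_{j+1} = Σ (source totals)·C^{exit}_j` (hence, with §4, `Σ_{v ∈ κ′-exit slice} C^{exit}_j(κ′,v)·colMass = 0`) and the cases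
  `Lc ∈ {1, 2}`.  The fm block stays FALSE (PART 1 §3).
Asserts NO value beyond the typed letters; NOTHING of (W-γ)'s exit sub-row ∕ (INV) ∕ (S) ∕ (Q-R) ∕ (LT) ∕ (Q-L) ∕ (C) ∕ «T2Shape» ∕ (hW, hWall) discharged; NEVER «G-an2-4 closed» as (CONV-C);
NOT D1, NOT `BetaPertH`, NOT continuum, NOT Clay.  2026-08-22; no existing file touched.
-/

noncomputable section

open Finset
open scoped BigOperators
open Literature.MathematicalPhysics.QuantumFieldTheory
open Literature.MathematicalPhysics.QuantumFieldTheory.Balaban1983to89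
open Literature.MathematicalPhysics.QuantumFieldTheory.Balaban1983to89.Beta
open B12Sec2to5 (l1)
open ExpKernelCalculus (Site MKer BiLoc Decays shiftK Zl)
open OneStepResolventKernel (Fib LocStencil wsum)
open OneStepKernelFamily (KInvStep colH)
open AffineAveraging (box toSite)
open AveragingContoursRooted (ctrOff ctrOff_mem_box)
open AveragingContours (blk)
open ExpKernelCalculus (comp)
open SecondOrderResponse (dM)
open InterLevelTransport (cwsum)
open BalabanStepJetsSucc (wE wVH)
open Summit.QuantumFields.BalabanUV.Beta.AxialDressingRooted (coDressKBmAt decays_coDressKBmAt_KInvStep)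
open Summit.QuantumFields.BalabanUV.Beta.BorderedHessian (stepScale)
open Summit.QuantumFields.BalabanUV.Beta.SpineRooted (SpureRecAt M1At)
open Summit.QuantumFields.BalabanUV.Beta.KernelWardRelative (gaugeWt)
open Summit.QuantumFields.BalabanUV.Beta.WardLocusRecursive (SrecAt SrecAt_translate locStencil_SrecAt)
open Summit.QuantumFields.BalabanUV.Beta.GAN24.LinT2ZeroModeStep (colMass)
open Summit.QuantumFields.BalabanUV.Beta.GAN24.CoDressedColumnSourceSums (tsum_source_colH_coDressKBm_KInvStep)
open Summit.QuantumFields.BalabanUV.Beta.GAN24.WardResidualRotatedVertexPeriodic (summable_colH_mul_of_bdd tsum_colH_mul_eq_blockSum_of_periodic)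
open Summit.QuantumFields.BalabanUV.Beta.GAN24.GaugeReadChargeDipole (abs_tsum_prod_le_of_biLoc)
open Summit.QuantumFields.BalabanUV.Beta.GAN24.SpureSlotChargeLevelZero (tsum_prod_spureRecAt_zero_inl_inl)
open Summit.QuantumFields.BalabanUV.Beta.GAN24.SpureSlotChargeLevelOne (tsum_prod_exitPair_eq_iterated tsum_prod_spureRecAt_succ_inl_inl_colH)
open Summit.QuantumFields.BalabanUV.Beta.GAN24.WardGammaPlainRowCentred (hasSum_comb_gaugeCharge_plain_ctr)
open Summit.QuantumFields.BalabanUV.Beta.HessKerDressedUnits (unitS unitS_apply legScale_inl)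
open Summit.QuantumFields.BalabanUV.Beta.GAN24.ThreeFaceRecClosed (hasSum_unitS_SpureRecAt)

namespace Summit.QuantumFields.BalabanUV.Beta.GAN24.SpureSlotChargeAllLevels

variable {d : ℕ}

/-! ## §1 The exit⊗exit slot-charge function of every member is `Lc`-periodic and bounded -/

/-- [folklore] The exit indicator is `L`-periodic. -/
theorem exitFace_add_zsmul (L : ℕ) (c : Fin (d + 1)) (x v : Site (d + 1)) :
    (if (x + (L : ℤ) • v) c % (L : ℤ) = (L : ℤ) - 1 then (1 : ℝ) else 0) = if x c % (L : ℤ) = (L : ℤ) - 1 then (1 : ℝ) else 0 := by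
  have e : (x + (L : ℤ) • v) c % (L : ℤ) = x c % (L : ℤ) := by
    simp only [Pi.add_apply, Pi.smul_apply, smul_eq_mul]
    rw [mul_comm, Int.add_mul_emod_self_right]
  rw [e]

/-- NOT IN PRINT; OUR BOOKKEEPING.  **THE EXIT⊗EXIT SLOT-CHARGE FUNCTION OF EVERY MEMBER IS `Lc`-PERIODIC IN THE SLOT** (any root `ρ`, every `j`):
`C^{exit}(SrecAt j; κ, u + Lc•t; α,β) = C^{exit}(SrecAt j; κ, u; α,β)` — block covariance `SrecAt_translate` (the table at the shifted slot is the shifted table) and the periodicity of the exit weights. -/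
theorem exitCharge_srecAt_add_zsmul {Lc : ℕ} [NeZero Lc] (hLc : 1 ≤ Lc) (ρ : Fin (d + 1) → ℤ) (cE cVH cΛ : ℝ) (j : ℕ) (κ : Fin (d + 1)) (u t : Site (d + 1))
    (α β : Fin (d + 1)) :
    ∑' z, (if z β % (Lc : ℤ) = (Lc : ℤ) - 1 then (1 : ℝ) else 0) *
        ∑' x, (if x α % (Lc : ℤ) = (Lc : ℤ) - 1 then (1 : ℝ) else 0) * SrecAt d Lc ρ cE cVH cΛ j κ (u + (Lc : ℤ) • t) x z (Sum.inl α) (Sum.inl β)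
      = ∑' z, (if z β % (Lc : ℤ) = (Lc : ℤ) - 1 then (1 : ℝ) else 0) *
        ∑' x, (if x α % (Lc : ℤ) = (Lc : ℤ) - 1 then (1 : ℝ) else 0) * SrecAt d Lc ρ cE cVH cΛ j κ u x z (Sum.inl α) (Sum.inl β) := by
  rw [SrecAt_translate ρ hLc cE cVH cΛ j κ u t]
  simp only [ExpKernelCalculus.shiftK]
  -- reindex both legs by `· ↦ · + Lc•t`
  set c : Site (d + 1) := (Lc : ℤ) • t with hc
  have hin : ∀ z : Site (d + 1), ∑' x, (if x α % (Lc : ℤ) = (Lc : ℤ) - 1 then (1 : ℝ) else 0) * SrecAt d Lc ρ cE cVH cΛ j κ u (x + -c) (z + -c) (Sum.inl α) (Sum.inl β)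
      = ∑' x, (if x α % (Lc : ℤ) = (Lc : ℤ) - 1 then (1 : ℝ) else 0) * SrecAt d Lc ρ cE cVH cΛ j κ u x (z + -c) (Sum.inl α) (Sum.inl β) := by
    intro z
    rw [← (Equiv.addRight c).tsum_eq (fun x => (if x α % (Lc : ℤ) = (Lc : ℤ) - 1 then (1 : ℝ) else 0)
      * SrecAt d Lc ρ cE cVH cΛ j κ u (x + -c) (z + -c) (Sum.inl α) (Sum.inl β))]
    refine tsum_congr fun x => ?_
    simp only [Equiv.coe_addRight, add_neg_cancel_right, hc, exitFace_add_zsmul]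
  simp only [hin]
  rw [← (Equiv.addRight c).tsum_eq (fun z => (if z β % (Lc : ℤ) = (Lc : ℤ) - 1 then (1 : ℝ) else 0)
    * ∑' x, (if x α % (Lc : ℤ) = (Lc : ℤ) - 1 then (1 : ℝ) else 0) * SrecAt d Lc ρ cE cVH cΛ j κ u x (z + -c) (Sum.inl α) (Sum.inl β))]
  refine tsum_congr fun z => ?_
  simp only [Equiv.coe_addRight, add_neg_cancel_right, hc, exitFace_add_zsmul]

/-- [folklore] The exit⊗exit-masked entries of a bi-localised kernel are bi-localised with the same constants. -/
theorem biLoc_exitPair_mul {L : ℕ} {T : MKer (d + 1) (Fib d)} {p : Site (d + 1)} {C δ : ℝ} (hT : BiLoc T p p C δ) (α β : Fin (d + 1)) :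
    BiLoc (fun x z a b => (if x α % (L : ℤ) = (L : ℤ) - 1 ∧ z β % (L : ℤ) = (L : ℤ) - 1 then T x z a b else 0)) p p C δ := by
  intro x z a b
  show |(if x α % (L : ℤ) = (L : ℤ) - 1 ∧ z β % (L : ℤ) = (L : ℤ) - 1 then T x z a b else 0)| ≤ _
  by_cases h : x α % (L : ℤ) = (L : ℤ) - 1 ∧ z β % (L : ℤ) = (L : ℤ) - 1
  · rw [if_pos h]; exact hT x z a b
  · rw [if_neg h, abs_zero]
    exact le_trans (abs_nonneg _) (hT x z a b)

/-- NOT IN PRINT; OUR BOOKKEEPING.  **A UNIFORM BOUND ON THE EXIT⊗EXIT SLOT-CHARGE FUNCTION** of a local table family (`LocStencil T Cs δs`, `0 < δs`): `|C^{exit}(T; κ,u;α,β)| ≤ Cs·Zl(δs)²`. -/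
theorem abs_exitCharge_le_of_locStencil {L : ℕ} {T : Fin (d + 1) → Site (d + 1) → MKer (d + 1) (Fib d)} {Cs δs : ℝ} (hT : LocStencil T Cs δs) (hδs : 0 < δs)
    (κ : Fin (d + 1)) (u : Site (d + 1)) (α β : Fin (d + 1)) :
    |∑' z, (if z β % (L : ℤ) = (L : ℤ) - 1 then (1 : ℝ) else 0) * ∑' x, (if x α % (L : ℤ) = (L : ℤ) - 1 then (1 : ℝ) else 0) * T κ u x z (Sum.inl α) (Sum.inl β)|
      ≤ Cs * (Zl (d + 1) δs * Zl (d + 1) δs) := by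
  rw [← tsum_prod_exitPair_eq_iterated (hT κ u) hδs α β]
  exact abs_tsum_prod_le_of_biLoc (biLoc_exitPair_mul (L := L) (hT κ u) α β) hδs (Sum.inl α) (Sum.inl β)

/-! ## §2 The plain ff slot charge at level `j+1` is a box sum of source totals against the periodic `C^{exit}_j`: slot-constancy at every level -/

/-- NOT IN PRINT; OUR BOOKKEEPING.  **THE PLAIN ff SLOT CHARGE OF THE PURE S TABLE AT LEVEL `j+1` IN CLOSED, SLOT-FREE FORM** (in-block root `ρ = toSite r`, EVERY `j`, every `cE cVH cΛ`,
slot `(κ′,u′)`, ff channel `(α,β)`):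
`Σ'_{(x,z)} SpureRecAt … (j+1) κ′ u′ x z (inl α)(inl β) = (cE·wE_{j+1})·Lc²σ_j²·Σ_κ Σ_{v∈box} (𝟙[v_κ % Lc = Lc−1]·Lc·colMass d Lc j κ κ′)·C^{exit}(SrecAt j; κ, v; α,β)` — the right side does NOT
contain `u′`: PART 3's ℋ-column read ⨾ §1's periodicity ⨾ road-P2's block-sum lemma ⨾ leaf-02 g51's source totals. -/
theorem tsum_prod_spureRecAt_succ_inl_inl_eq_boxSum {Lc : ℕ} [NeZero Lc] {r : Fin (d + 1) → ℕ} (hr : r ∈ box (d + 1) Lc) (cE cVH cΛ : ℝ) (j : ℕ)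
    (κ' : Fin (d + 1)) (u' : Site (d + 1)) (α β : Fin (d + 1)) :
    ∑' xz : Site (d + 1) × Site (d + 1), SpureRecAt d Lc (toSite r) cE cVH cΛ (j + 1) κ' u' xz.1 xz.2 (Sum.inl α) (Sum.inl β)
      = (cE * wE d Lc (j + 1)) * ((Lc : ℝ) ^ 2 * (((((Lc ^ (j + 1) : ℕ) : ℝ)) ^ (d + 1 + 1))⁻¹) ^ 2 *
        ∑ κ : Fin (d + 1), ∑ v ∈ box (d + 1) Lc,
          (if (toSite v) κ % (Lc : ℤ) = (Lc : ℤ) - 1 then (Lc : ℝ) * colMass d Lc j κ κ' else 0) *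
            ∑' z, (if z β % (Lc : ℤ) = (Lc : ℤ) - 1 then (1 : ℝ) else 0) *
              ∑' x, (if x α % (Lc : ℤ) = (Lc : ℤ) - 1 then (1 : ℝ) else 0) * SrecAt d Lc (toSite r) cE cVH cΛ j κ (toSite v) x z (Sum.inl α) (Sum.inl β)) := by
  have hLc : 1 ≤ Lc := Nat.one_le_iff_ne_zero.2 (NeZero.ne Lc)
  obtain ⟨Cs, δs, hδs, hS⟩ := locStencil_SrecAt (d := d) (Lc := Lc) hLc hr cE cVH cΛ j
  obtain ⟨δ, C, hδ, -, hG⟩ := decays_coDressKBmAt_KInvStep (d := d) hr j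
  -- per direction `κ`: the slot function `Z := C^{exit}_j(κ, ·)` is periodic and bounded, so the column read is a block sum of source totals
  have key : ∀ κ : Fin (d + 1),
      ∑' t : Site (d + 1), colH (coDressKBmAt (toSite r) Lc (KInvStep (d := d) Lc j)) Lc κ' u' κ t *
          ∑' z, (if z β % (Lc : ℤ) = (Lc : ℤ) - 1 then (1 : ℝ) else 0) *
            ∑' x, (if x α % (Lc : ℤ) = (Lc : ℤ) - 1 then (1 : ℝ) else 0) * SrecAt d Lc (toSite r) cE cVH cΛ j κ t x z (Sum.inl α) (Sum.inl β)
        = ∑ v ∈ box (d + 1) Lc,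
          (if (toSite v) κ % (Lc : ℤ) = (Lc : ℤ) - 1 then (Lc : ℝ) * colMass d Lc j κ κ' else 0) *
            ∑' z, (if z β % (Lc : ℤ) = (Lc : ℤ) - 1 then (1 : ℝ) else 0) *
              ∑' x, (if x α % (Lc : ℤ) = (Lc : ℤ) - 1 then (1 : ℝ) else 0) * SrecAt d Lc (toSite r) cE cVH cΛ j κ (toSite v) x z (Sum.inl α) (Sum.inl β) := by
    intro κ
    have hZp : ∀ (t : Site (d + 1)) (v : Fin (d + 1) → ℕ),
        (fun t : Site (d + 1) => ∑' z, (if z β % (Lc : ℤ) = (Lc : ℤ) - 1 then (1 : ℝ) else 0) *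
          ∑' x, (if x α % (Lc : ℤ) = (Lc : ℤ) - 1 then (1 : ℝ) else 0) * SrecAt d Lc (toSite r) cE cVH cΛ j κ t x z (Sum.inl α) (Sum.inl β)) ((Lc : ℤ) • t + toSite v)
        = (fun t : Site (d + 1) => ∑' z, (if z β % (Lc : ℤ) = (Lc : ℤ) - 1 then (1 : ℝ) else 0) *
          ∑' x, (if x α % (Lc : ℤ) = (Lc : ℤ) - 1 then (1 : ℝ) else 0) * SrecAt d Lc (toSite r) cE cVH cΛ j κ t x z (Sum.inl α) (Sum.inl β)) (toSite v) := fun t v => by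
      simp only []
      rw [add_comm ((Lc : ℤ) • t) (toSite v)]
      exact exitCharge_srecAt_add_zsmul hLc (toSite r) cE cVH cΛ j κ (toSite v) t α β
    have hZb : ∀ t : Site (d + 1), |(fun t : Site (d + 1) => ∑' z, (if z β % (Lc : ℤ) = (Lc : ℤ) - 1 then (1 : ℝ) else 0) *
          ∑' x, (if x α % (Lc : ℤ) = (Lc : ℤ) - 1 then (1 : ℝ) else 0) * SrecAt d Lc (toSite r) cE cVH cΛ j κ t x z (Sum.inl α) (Sum.inl β)) t|
        ≤ Cs * (Zl (d + 1) δs * Zl (d + 1) δs) := fun t => abs_exitCharge_le_of_locStencil hS hδs κ t α β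
    have hsum := summable_colH_mul_of_bdd (Lc := Lc) hG hδ κ' κ u' hZb
    have h := tsum_colH_mul_eq_blockSum_of_periodic (Lc := Lc) r j κ' κ u' hZp hsum
    rw [h]
    refine Finset.sum_congr rfl fun v _ => ?_
    rw [tsum_source_colH_coDressKBm_KInvStep hr j κ' κ ((Lc : ℤ) • u' + toSite v)]
    have e : ((Lc : ℤ) • u' + toSite v) κ % (Lc : ℤ) = (toSite v) κ % (Lc : ℤ) := by
      simp only [Pi.add_apply, Pi.smul_apply, smul_eq_mul]
      rw [add_comm, mul_comm, Int.add_mul_emod_self_right]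
    rw [e]
  rw [tsum_prod_spureRecAt_succ_inl_inl_colH hr cE cVH cΛ j κ' u' α β]
  simp only [key]

/-- NOT IN PRINT; OUR BOOKKEEPING.  **`hζS` AT LEVEL `j+1` ON THE ff BLOCK, EVERY `j`**: there is `ζS : Fin (d+1) → ℝ` (the closed box sum of the previous theorem) with
`∀ κ′ u′, Σ'_{(x,z)} SpureRecAt … (j+1) κ′ u′ x z (inl α)(inl β) = ζS κ′`. -/
theorem exists_slotConst_spureRecAt_succ_inl_inl {Lc : ℕ} [NeZero Lc] {r : Fin (d + 1) → ℕ} (hr : r ∈ box (d + 1) Lc) (cE cVH cΛ : ℝ) (j : ℕ) (α β : Fin (d + 1)) :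
    ∃ ζS : Fin (d + 1) → ℝ, ∀ (κ' : Fin (d + 1)) (u' : Site (d + 1)),
      ∑' xz : Site (d + 1) × Site (d + 1), SpureRecAt d Lc (toSite r) cE cVH cΛ (j + 1) κ' u' xz.1 xz.2 (Sum.inl α) (Sum.inl β) = ζS κ' :=
  ⟨fun κ' => (cE * wE d Lc (j + 1)) * ((Lc : ℝ) ^ 2 * (((((Lc ^ (j + 1) : ℕ) : ℝ)) ^ (d + 1 + 1))⁻¹) ^ 2 *
        ∑ κ : Fin (d + 1), ∑ v ∈ box (d + 1) Lc,
          (if (toSite v) κ % (Lc : ℤ) = (Lc : ℤ) - 1 then (Lc : ℝ) * colMass d Lc j κ κ' else 0) *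
            ∑' z, (if z β % (Lc : ℤ) = (Lc : ℤ) - 1 then (1 : ℝ) else 0) *
              ∑' x, (if x α % (Lc : ℤ) = (Lc : ℤ) - 1 then (1 : ℝ) else 0) * SrecAt d Lc (toSite r) cE cVH cΛ j κ (toSite v) x z (Sum.inl α) (Sum.inl β)),
    fun κ' u' => tsum_prod_spureRecAt_succ_inl_inl_eq_boxSum hr cE cVH cΛ j κ' u' α β⟩

/-- NOT IN PRINT; OUR BOOKKEEPING.  **ROAD-P2's DISPLAYED `hζS` HOLDS ON THE FIELD–FIELD BLOCK AT EVERY LEVEL** (in-block root, every `cE cVH cΛ`, every `j`, every ff channel `(α,β)`):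
`∃ ζS, ∀ κ u, Σ'_{(x,z)} SpureRecAt d Lc (toSite r) cE cVH cΛ j κ u x z (inl α)(inl β) = ζS κ` — `j = 0` by PART 1 (`ζS = 0`), `j+1` by §2. -/
theorem exists_slotConst_spureRecAt_inl_inl {Lc : ℕ} [NeZero Lc] (hLc : 1 ≤ Lc) {r : Fin (d + 1) → ℕ} (hr : r ∈ box (d + 1) Lc) (cE cVH cΛ : ℝ) (α β : Fin (d + 1)) :
    ∀ j : ℕ, ∃ ζS : Fin (d + 1) → ℝ, ∀ (κ : Fin (d + 1)) (u : Site (d + 1)),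
      ∑' xz : Site (d + 1) × Site (d + 1), SpureRecAt d Lc (toSite r) cE cVH cΛ j κ u xz.1 xz.2 (Sum.inl α) (Sum.inl β) = ζS κ
  | 0 => ⟨fun _ => 0, fun κ u => tsum_prod_spureRecAt_zero_inl_inl hLc hr cE cVH cΛ κ u α β⟩
  | j + 1 => exists_slotConst_spureRecAt_succ_inl_inl hr cE cVH cΛ j α β

/-! ## §3 The consumer: road-P2's plain (γ) row at the centre with no displayed hypothesis on the ff block -/

/-- NOT IN PRINT; OUR BOOKKEEPING.  **THE PLAIN ff CHARGE OF THE (γ) COMB LETTER AT BAŁABAN's CENTRE, EVERY LEVEL, NO DISPLAYED HYPOTHESIS** (`Lc` odd; every `cE cVH cΛ`, level `j`, label `y`,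
slot `(ν,y′)`, channel `(inl α, inl β)`): there is `ζS` (the slot-constant plain ff charge of `SpureRecAt j`, §2) such that road-P2's `hasSum_comb_gaugeCharge_plain_ctr` gives the (γ) letter's plain
charge the (T-F) value `Σ_κ (−2·(cVH·wVH_j)·(σ_j·Lc^{d+1})⁻¹·W^{α⁺}_κ(ν,y′))·ζS κ`. -/
theorem exists_hasSum_comb_gaugeCharge_plain_ctr_inl_inl {Lc : ℕ} [NeZero Lc] (hodd : Odd Lc) (cE cVH cΛ : ℝ) (j : ℕ) (y : Site (d + 1)) (ν : Fin (d + 1)) (y' : Site (d + 1))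
    (α β : Fin (d + 1)) :
    ∃ ζS : Fin (d + 1) → ℝ,
      (∀ (κ : Fin (d + 1)) (u : Site (d + 1)),
          ∑' xz : Site (d + 1) × Site (d + 1), SpureRecAt d Lc (toSite (ctrOff (d + 1) Lc)) cE cVH cΛ j κ u xz.1 xz.2 (Sum.inl α) (Sum.inl β) = ζS κ) ∧
      HasSum (fun xz : Site (d + 1) × Site (d + 1) =>
        (∑ κ, wsum (fun u => ∑' x₂, ∑ κ₂,
              comp (coDressKBmAt (toSite (ctrOff (d + 1) Lc)) Lc (KInvStep (d := d) Lc j))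
                (dM (coDressKBmAt (toSite (ctrOff (d + 1) Lc)) Lc (KInvStep (d := d) Lc j)) Lc (SpureRecAt d Lc (toSite (ctrOff (d + 1) Lc)) cE cVH cΛ j)
                  (M1At d Lc (toSite (ctrOff (d + 1) Lc)) cΛ j) ν y')
                u x₂ (Sum.inl κ) (Sum.inl κ₂) * gaugeWt Lc y κ₂ x₂) (SpureRecAt d Lc (toSite (ctrOff (d + 1) Lc)) cE cVH cΛ j κ)
          + ∑ ρ', cwsum Lc (fun w => ∑' x₂, ∑ κ₂,
              comp (coDressKBmAt (toSite (ctrOff (d + 1) Lc)) Lc (KInvStep (d := d) Lc j))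
                (dM (coDressKBmAt (toSite (ctrOff (d + 1) Lc)) Lc (KInvStep (d := d) Lc j)) Lc (SpureRecAt d Lc (toSite (ctrOff (d + 1) Lc)) cE cVH cΛ j)
                  (M1At d Lc (toSite (ctrOff (d + 1) Lc)) cΛ j) ν y')
                ((Lc : ℤ) • w) x₂ (Sum.inr ρ') (Sum.inl κ₂) * gaugeWt Lc y κ₂ x₂) (M1At d Lc (toSite (ctrOff (d + 1) Lc)) cΛ j ρ')) xz.1 xz.2 (Sum.inl α) (Sum.inl β))
      (∑ κ, ((-(2 * (cVH * wVH d Lc j) * (stepScale d Lc j * (Lc : ℝ) ^ (d + 1))⁻¹)) *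
            ∑' u, colH (coDressKBmAt (toSite (ctrOff (d + 1) Lc)) Lc (KInvStep (d := d) Lc j)) Lc ν y' κ u
              * ((if y' + Pi.single ν 1 = y then (1 / 2 : ℝ) else 0) - (if blk Lc (u + Pi.single κ 1) = y then (1 / 2 : ℝ) else 0))) * ζS κ) := by
  have hLc : 1 ≤ Lc := Nat.one_le_iff_ne_zero.mpr (NeZero.ne Lc)
  obtain ⟨ζS, hζS⟩ := exists_slotConst_spureRecAt_inl_inl hLc (ctrOff_mem_box hLc) cE cVH cΛ α β j
  exact ⟨ζS, hζS, hasSum_comb_gaugeCharge_plain_ctr (d := d) hodd cE cVH cΛ j y ν y' (Sum.inl α) (Sum.inl β) hζS⟩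

/-! ## §4 The value at every level, by name: leaf-04's «S3C-REC» first conjunct in road-P2's currency -/

/-- NOT IN PRINT; OUR BOOKKEEPING.  **THE PLAIN ff PAIR CHARGE OF THE PURE S TABLE VANISHES AT EVERY SLOT AND EVERY LEVEL** (`3 ≤ Lc`, in-block root, every `cE cVH cΛ`, `j`, `(κ,u)`,
`(α,β)`): `Σ'_{(x,z)} SpureRecAt d Lc (toSite r) cE cVH cΛ j κ u x z (inl α)(inl β) = 0` — leaf-04 g63's `ThreeFaceRecClosed.hasSum_unitS_SpureRecAt` (p332870), FIRST conjunct, at the unit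
scales `sf = sm = 1` (where `unitS 1 1 S = S` entrywise).  PRIOR ART BY NAME: this is THEIR theorem read in this file's currency, not a new result. -/
theorem tsum_prod_spureRecAt_inl_inl_eq_zero {Lc : ℕ} [NeZero Lc] (hLc : 3 ≤ Lc) {r : Fin (d + 1) → ℕ} (hr : r ∈ box (d + 1) Lc) (cE cVH cΛ : ℝ) (j : ℕ)
    (κ : Fin (d + 1)) (u : Site (d + 1)) (α β : Fin (d + 1)) :
    ∑' xz : Site (d + 1) × Site (d + 1), SpureRecAt d Lc (toSite r) cE cVH cΛ j κ u xz.1 xz.2 (Sum.inl α) (Sum.inl β) = 0 := by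
  have h := (hasSum_unitS_SpureRecAt (d := d) hLc hr cE cVH cΛ j 1 1 κ α β u).1
  have e : (fun p : Site (d + 1) × Site (d + 1) => unitS 1 1 (SpureRecAt d Lc (toSite r) cE cVH cΛ j) κ u p.1 p.2 (Sum.inl α) (Sum.inl β))
      = fun p => SpureRecAt d Lc (toSite r) cE cVH cΛ j κ u p.1 p.2 (Sum.inl α) (Sum.inl β) := by
    funext p
    simp only [unitS_apply, legScale_inl, inv_one, mul_one, one_mul]
  rw [e] at h
  exact h.tsum_eq

/-- NOT IN PRINT; OUR BOOKKEEPING.  **AT BAŁABAN's CENTRE THE PLAIN ff CHARGE OF THE (γ) COMB LETTER VANISHES PER SLOT AT EVERY LEVEL** (`Lc` odd, `3 ≤ Lc`; every `cE cVH cΛ`, `j`, label `y`,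
slot `(ν,y′)`, channel `(inl α, inl β)`): road-P2's `hasSum_comb_gaugeCharge_plain_ctr` fed with `ζS := 0` from leaf-04's theorem (previous lemma). -/
theorem hasSum_comb_gaugeCharge_plain_ctr_inl_inl_eq_zero {Lc : ℕ} [NeZero Lc] (hodd : Odd Lc) (hLc : 3 ≤ Lc) (cE cVH cΛ : ℝ) (j : ℕ) (y : Site (d + 1)) (ν : Fin (d + 1))
    (y' : Site (d + 1)) (α β : Fin (d + 1)) :
    HasSum (fun xz : Site (d + 1) × Site (d + 1) =>
        (∑ κ, wsum (fun u => ∑' x₂, ∑ κ₂,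
              comp (coDressKBmAt (toSite (ctrOff (d + 1) Lc)) Lc (KInvStep (d := d) Lc j))
                (dM (coDressKBmAt (toSite (ctrOff (d + 1) Lc)) Lc (KInvStep (d := d) Lc j)) Lc (SpureRecAt d Lc (toSite (ctrOff (d + 1) Lc)) cE cVH cΛ j)
                  (M1At d Lc (toSite (ctrOff (d + 1) Lc)) cΛ j) ν y')
                u x₂ (Sum.inl κ) (Sum.inl κ₂) * gaugeWt Lc y κ₂ x₂) (SpureRecAt d Lc (toSite (ctrOff (d + 1) Lc)) cE cVH cΛ j κ)
          + ∑ ρ', cwsum Lc (fun w => ∑' x₂, ∑ κ₂,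
              comp (coDressKBmAt (toSite (ctrOff (d + 1) Lc)) Lc (KInvStep (d := d) Lc j))
                (dM (coDressKBmAt (toSite (ctrOff (d + 1) Lc)) Lc (KInvStep (d := d) Lc j)) Lc (SpureRecAt d Lc (toSite (ctrOff (d + 1) Lc)) cE cVH cΛ j)
                  (M1At d Lc (toSite (ctrOff (d + 1) Lc)) cΛ j) ν y')
                ((Lc : ℤ) • w) x₂ (Sum.inr ρ') (Sum.inl κ₂) * gaugeWt Lc y κ₂ x₂) (M1At d Lc (toSite (ctrOff (d + 1) Lc)) cΛ j ρ')) xz.1 xz.2 (Sum.inl α) (Sum.inl β))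
      0 := by
  have hLc1 : 1 ≤ Lc := by omega
  have h := hasSum_comb_gaugeCharge_plain_ctr (d := d) hodd cE cVH cΛ j y ν y' (Sum.inl α) (Sum.inl β) (ζS := fun _ => (0 : ℝ))
    (fun κ u => tsum_prod_spureRecAt_inl_inl_eq_zero hLc (ctrOff_mem_box hLc1) cE cVH cΛ j κ u α β)
  simp only [mul_zero, Finset.sum_const_zero] at h
  exact h

end Summit.QuantumFields.BalabanUV.Beta.GAN24.SpureSlotChargeAllLevels

end
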